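import Literature.NumberTheory.EllipticCurves.NewformsStrongMultiplicityOne
import Literature.NumberTheory.EllipticCurves.NewformsLevelLowering
import Literature.NumberTheory.EllipticCurves.CuspFormLFunctionNewformFrickeProofs
import Literature.NumberTheory.EllipticCurves.NewformsHeckeStableProofs
import HarnessLib

/-!
# `p`-old and `p`-new cusp forms on `Γ₀(N)`: the `p`-primary old/new dichotomy
# (trunk EllArithM; `Newforms.lean` continued — input to strong multiplicity one across levels)

Fix a prime `p` and a level `N = p M`. Following Diamond–Shurman, Def. 5.6.1 (the map
`i_p : (S_k(Γ₁(N p⁻¹)))² → S_k(Γ₁(N))`, `(f, g) ↦ f + g[α_p]_k`, PDF p. 209 of the held copy), the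
**`p`-old subspace** of `S_k(Γ₀(N))` is the image of `i_p`,

  `range [Γ₀(M) 1 Γ₀(N)]_k + range [Γ₀(M) diag(p,1) Γ₀(N)]_k`
  (`= LinearMap.range (degeneracyMap0 M N 1 k) ⊔ LinearMap.range (degeneracyMap0 M N p k)`),

and the **`p`-new subspace** is the joint kernel of the two adjoint degeneracy maps
`[Γ₀(N) 1 Γ₀(M)]_k` (trace) and `[Γ₀(N) diag(1,p) Γ₀(M)]_k` of `Newforms.lean`
(`= ker (adjDegeneracyMap0 N M 1 k) ⊓ ker (adjDegeneracyMap0 N M p k)`; the adjoint `i_p^*`,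
Diamond–Shurman Prop. 5.5.2 and Exercise 5.7.2). No definition is introduced: both subspaces are
written out in the statements. This file proves:

* `disjoint_pOld_pNew` — **`p`-old ∩ `p`-new `= 0`**: by the adjointness of the two pairs of
  degeneracy maps (`peterssonProduct_degeneracyMap0_left`, Li 1975 Lemma 5 / Diamond–Shurman
  Prop. 5.5.2) a form in both is Petersson-orthogonal to itself, hence `0`
  (`eq_zero_of_peterssonProduct_self_eq_zero`, Diamond–Shurman §5.4) — the same argument as
  `disjoint_oldSubspace0_newSubspace0_holds` of `NewformsOldNewProofs`, run for the two indices
  `(M, 1)`, `(M, p)` only.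
* `newSubspace0_le_pNew`: new forms are `p`-new (two of the defining kernels).
* `map_degeneracyMap0_le_pOld_of_dvd`, `map_degeneracyMap0_le_pOld_of_mul` — **low `p`-level is
  `p`-old**: `[diag(d,1)]_k S_k(Γ₀(M₀)) ⊆ p-old` whenever `M₀ d ∣ M`, or `d = d₀ p` with `M₀ d₀ ∣ M`
  (composition of degeneracy maps through level `M`, Diamond–Shurman Exercise 5.6.2).
* `degeneracyMap0_mem_pNew` — **full `p`-level is `p`-new**: if `N = M₀ d c` with `p ∤ d c`
  (so `v_p(M₀) = v_p(N) ≥ 1`, `M₀ = p Q`) and `n ∈ S_k(Γ₀(M₀))^{new}`, then `[diag(d,1)]_k n` is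
  `p`-new at level `N`. For the `diag(1,p)` map this is the explicit coset computation of Knapp 1993,
  Lemma 9.26 at both levels (`coe_adjDegeneracyMap0_eq_sum`, `…_of_dvd` of
  `CuspFormLFunctionNewformFrickeProofs`: the map is `U_p` (`p² ∣` level) or `U_p + [W_p]_k`
  (`p ∥` level)), together with `diag(d,1) (1 j; 0 p) = T^m (1, dj mod p; 0 p) diag(d,1)`
  (`tpD_mul_tpB`, so `U_p` commutes with `[diag(d,1)]_k` for `p ∤ d`, `sum_slash_tpD_slash_tpB`) and
  the compatibility `diag(d,1) W_p^{(N)} = W_p^{(M₀)} diag(d,1)` of Atkin–Lehner matrices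
  (`adjDegeneracyMap0_p_degeneracyMap0_eq_zero`). For the trace map it is reduced to the previous
  case by the Fricke involutions: `adj_d (w_N f) = c · (adj_{d'} f) ∣ w_M` for `M d d' = N`
  (`adjDegeneracyMap0_frickeInvolution_eq_zero`, the computation of
  `frickeInvolution_mem_newSubspace0` of `CuspFormLFunctionFrickeProofs`; Atkin–Lehner 1970,
  Lemma 26) and `w_N [diag(d,1)]_k = c' · [diag(c,1)]_k w_{M₀}` on `S_k(Γ₀(M₀))`
  (`exists_frickeInvolution_degeneracyMap0_eq_smul`, via the matrix identity `tpD_mul_frickeGL_eq` of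
  `NewformsHeckeStableProofs`; Diamond–Shurman, proof of Prop. 5.6.2, third diagram, PDF p. 210),
  `w_{M₀}` preserving `S_k(Γ₀(M₀))^{new}`.

These are the inputs of the `p`-primary proof of strong multiplicity one across levels
(Atkin–Lehner 1970, Thm. 4) in `NewformsLevelEqOfHeckeEigenvalueEqProofs`: at a prime `p` where the
levels `N ∣ L/p` and `N'` (`v_p(N') = v_p(L)`) of two newforms with the same eigenvalues differ,
`f` is `p`-old and `g` is `p`-new at the common level `L`, and every Atkin–Lehner component
`[diag(d,1)]_k S_k(Γ₀(M₀))^{new}`, `d ≠ 1`, of `S_k(Γ₀(L))` is one or the other.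

## References

* F. Diamond, J. Shurman, *A first course in modular forms*, GTM 228, Springer 2005 (lit store
  `book:diamond2005-first-course-modular-forms`, PDF page = printed page + 20): Def. 5.6.1 and
  proof of Prop. 5.6.2 (PDF pp. 209–210), Prop. 5.5.2, Exercises 5.6.2, 5.7.2.
* A. W. Knapp, *Elliptic curves*, Princeton 1993, Lemma 9.26 (lit store
  `book:knapp1993-elliptic-curves-volume-40`).
* A. O. L. Atkin, J. Lehner, *Hecke operators on `Γ₀(m)`*, Math. Ann. 185 (1970), 134–160,
  Lemma 26, Thm. 4 (not held: acquisition request acq-00354; numbering as cited by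
  `CuspFormLFunctionFrickeProofs`).
* W.-C. W. Li, *Newforms and functional equations*, Math. Ann. 212 (1975), 285–315, Lemma 5.
-/

noncomputable section

open scoped MatrixGroups ModularForm

open CongruenceSubgroup UpperHalfPlane ConjAct Pointwise Matrix.SpecialLinearGroup ModularGroup

namespace Literature.NumberTheory.EllipticCurves.ModularForms

/-! ### `p`-old and `p`-new: disjointness, and the easy inclusions -/

section PSubspaces

variable {N M p : ℕ} [NeZero N] [NeZero M] [NeZero p] {k : ℤ}

/-- **`p`-old `∩` `p`-new `= 0`** on `S_k(Γ₀(N))`, `N = p M`: a form in the image of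
`i_p = [Γ₀(M) 1 Γ₀(N)]_k ⊕ [Γ₀(M) diag(p,1) Γ₀(N)]_k` (Diamond–Shurman Def. 5.6.1) that is killed by
the two adjoint maps `[Γ₀(N) 1 Γ₀(M)]_k`, `[Γ₀(N) diag(1,p) Γ₀(M)]_k` is Petersson-orthogonal to
itself (`peterssonProduct_degeneracyMap0_left`, Diamond–Shurman Prop. 5.5.2 / Exercise 5.7.2),
hence zero by definiteness (Diamond–Shurman §5.4). [cite: DiamondShurman2005, Def. 5.6.1 and Prop. 5.5.2] -/
theorem disjoint_pOld_pNew (hN : N = p * M) :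
    Disjoint (LinearMap.range (degeneracyMap0 M N 1 k) ⊔ LinearMap.range (degeneracyMap0 M N p k))
      (LinearMap.ker (adjDegeneracyMap0 N M 1 k) ⊓ LinearMap.ker (adjDegeneracyMap0 N M p k)) := by
  rw [Submodule.disjoint_def]
  intro x hold hnew
  have hM1 : M * 1 ∣ N := ⟨p, by rw [hN]; ring⟩
  have hMp : M * p ∣ N := ⟨1, by rw [hN]; ring⟩
  obtain ⟨h1, hp⟩ := Submodule.mem_inf.mp hnew
  rw [LinearMap.mem_ker] at h1 hp
  obtain ⟨y, hy, z, hz, rfl⟩ := Submodule.mem_sup.mp hold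
  obtain ⟨a, rfl⟩ := LinearMap.mem_range.mp hy
  obtain ⟨b, rfl⟩ := LinearMap.mem_range.mp hz
  have hP : peterssonProduct (Gamma0 N) k
      (degeneracyMap0 M N 1 k a + degeneracyMap0 M N p k b)
      (degeneracyMap0 M N 1 k a + degeneracyMap0 M N p k b) = 0 := by
    rw [peterssonProduct_add_left, peterssonProduct_degeneracyMap0_left M N 1 k hM1,
      peterssonProduct_degeneracyMap0_left M N p k hMp, h1, hp, peterssonProduct_zero_right,
      peterssonProduct_zero_right, add_zero]
  exact eq_zero_of_peterssonProduct_self_eq_zero k _ hP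

/-- New forms are `p`-new: `S_k(Γ₀(N))^{new} = ⋂_{(M',d)} ker [Γ₀(N) diag(1,d) Γ₀(M')]_k` lies in the
two kernels for `(M, 1)`, `(M, p)` (`N = p M`, `p > 1`). [folklore] -/
theorem newSubspace0_le_pNew (hN : N = p * M) (hp : 1 < p) :
    newSubspace0 N k ≤
      LinearMap.ker (adjDegeneracyMap0 N M 1 k) ⊓ LinearMap.ker (adjDegeneracyMap0 N M p k) := by
  intro f hf
  have hMN : M ∈ N.properDivisors := by
    rw [Nat.mem_properDivisors]
    refine ⟨⟨p, by rw [hN]; ring⟩, ?_⟩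
    rw [hN]
    exact lt_mul_left (NeZero.pos M) hp
  rw [newSubspace0, Submodule.mem_iInf] at hf
  exact Submodule.mem_inf.mpr
    ⟨hf ⟨(M, 1), hMN, ⟨p, by rw [hN]; ring⟩⟩, hf ⟨(M, p), hMN, ⟨1, by rw [hN]; ring⟩⟩⟩

/-- Raising the level through `M`: `[Γ₀(M) 1 Γ₀(N)]_k ∘ [Γ₀(M₀) diag(d,1) Γ₀(M)]_k =
[Γ₀(M₀) diag(d,1) Γ₀(N)]_k` for `M₀ d ∣ M ∣ N` — the case `d₂ = 1` of the composition law
`degeneracyMap0_degeneracyMap0` of `NewformsStrongMultiplicityOne` (Diamond–Shurman Exercise 5.6.2),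
restated without the product `d * 1` in the index. [cite: DiamondShurman2005, Exercise 5.6.2] -/
theorem degeneracyMap0_one_degeneracyMap0 {M₀ d : ℕ} [NeZero M₀] [NeZero d] (h : M₀ * d ∣ M)
    (hMN : M ∣ N) (f : CuspForm (Gamma0 M₀) k) :
    degeneracyMap0 M N 1 k (degeneracyMap0 M₀ M d k f) = degeneracyMap0 M₀ N d k f := by
  simpa using degeneracyMap0_degeneracyMap0 M₀ M N d 1 k h (by simpa using hMN) f

/-- **Low `p`-level is `p`-old, I:** `[diag(d,1)]_k S ⊆ p-old` for `S ⊆ S_k(Γ₀(M₀))`, `M₀ d ∣ M`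
(through the inclusion from level `M`; Diamond–Shurman Def. 5.6.1, Exercise 5.6.2). [cite: DiamondShurman2005, Exercise 5.6.2] -/
theorem map_degeneracyMap0_le_pOld_of_dvd {M₀ d : ℕ} [NeZero M₀] [NeZero d]
    (h : M₀ * d ∣ M) (hMN : M ∣ N) (S : Submodule ℂ (CuspForm (Gamma0 M₀) k)) :
    S.map (degeneracyMap0 M₀ N d k) ≤
      LinearMap.range (degeneracyMap0 M N 1 k) ⊔ LinearMap.range (degeneracyMap0 M N p k) := by
  rintro _ ⟨f, -, rfl⟩
  exact Submodule.mem_sup_left (LinearMap.mem_range.mpr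
    ⟨degeneracyMap0 M₀ M d k f, degeneracyMap0_one_degeneracyMap0 h hMN f⟩)

/-- **Low `p`-level is `p`-old, II:** `[diag(d₀ p,1)]_k S ⊆ p-old` for `S ⊆ S_k(Γ₀(M₀))`,
`M₀ d₀ ∣ M`, `M p ∣ N` (through `[diag(p,1)]_k` from level `M`, `degeneracyMap0_comp`;
Diamond–Shurman Exercise 5.6.2). [cite: DiamondShurman2005, Exercise 5.6.2] -/
theorem map_degeneracyMap0_le_pOld_of_mul {M₀ d₀ : ℕ} [NeZero M₀] [NeZero d₀]
    (h : M₀ * d₀ ∣ M) (hMN : M * p ∣ N) (S : Submodule ℂ (CuspForm (Gamma0 M₀) k)) :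
    S.map (degeneracyMap0 M₀ N (d₀ * p) k) ≤
      LinearMap.range (degeneracyMap0 M N 1 k) ⊔ LinearMap.range (degeneracyMap0 M N p k) := by
  rintro _ ⟨f, -, rfl⟩
  exact Submodule.mem_sup_right (LinearMap.mem_range.mpr
    ⟨degeneracyMap0 M₀ M d₀ k f, degeneracyMap0_degeneracyMap0 M₀ M N d₀ p k h hMN f⟩)

end PSubspaces

/-! ### `U_p` commutes with `[diag(d,1)]_k` for `p ∤ d` -/

section Reindex

variable (p d : ℕ) [NeZero p]

/-- `diag(d,1) (1 x; 0 p) = T^{⌊dx/p⌋} (1, dx mod p; 0 p) diag(d,1)` in `GL(2, ℝ)`. [folklore] -/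
theorem tpD_mul_tpB [NeZero d] (x : ℤ) :
    tpD d * tpB p x = mapGL ℝ (T ^ ((d : ℤ) * x / p)) * tpB p ((d : ℤ) * x % p) * tpD d := by
  have key : (((d : ℤ) * x % p : ℤ) : ℝ) + (p : ℝ) * (((d : ℤ) * x / p : ℤ) : ℝ) = (d : ℝ) * x := by
    exact_mod_cast Int.emod_add_mul_ediv ((d : ℤ) * x) p
  ext i j
  simp only [Units.val_mul, val_tpD, val_tpB, val_mapGL', coe_T_zpow]
  fin_cases i <;> fin_cases j <;>
    (simp [Matrix.mul_apply, Fin.sum_univ_two]; try linarith [key])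

/-- For `p` prime and `p ∤ d`, `j ↦ d j mod p` is a bijection of `{0, …, p-1}`. [folklore] -/
theorem bijective_mulMod (hp : p.Prime) (hd : ¬ p ∣ d) :
    Function.Bijective (fun j : Fin p ↦ (⟨d * j % p, Nat.mod_lt _ (NeZero.pos p)⟩ : Fin p)) := by
  rw [← Finite.injective_iff_bijective]
  intro j₁ j₂ h
  have h' : d * j₁ % p = d * j₂ % p := by simpa using congrArg Fin.val h
  have hmod : (j₁ : ℕ) ≡ j₂ [MOD p] :=
    Nat.ModEq.cancel_left_of_coprime
      (by simpa [Nat.coprime_comm] using (Nat.Prime.coprime_iff_not_dvd hp).mpr hd) h'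
  exact Fin.ext (Nat.ModEq.eq_of_lt_of_lt hmod j₁.2 j₂.2)

variable {p d} {M₀ : ℕ} {k : ℤ}

/-- **`U_p` commutes with `[diag(d,1)]_k` for `p ∤ d`**, at the level of the defining sums: for
`f` of any level `Γ₀(M₀)` (so `T`-invariant),
`∑_{j mod p} (f ∣ diag(d,1)) ∣ (1 j; 0 p) = (∑_{j mod p} f ∣ (1 j; 0 p)) ∣ diag(d,1)`, by
`tpD_mul_tpB` and reindexing `j ↦ dj mod p` (Diamond–Shurman, proof of Prop. 5.6.2, first
diagram: `T_{p'}` commutes with `i_p` for `p' ≠ p`, PDF p. 209). [cite: DiamondShurman2005, Prop. 5.6.2 (first diagram)] -/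
theorem sum_slash_tpD_slash_tpB [NeZero d] (hp : p.Prime) (hd : ¬ p ∣ d) (f : CuspForm (Gamma0 M₀) k) :
    ∑ j : Fin p, ((⇑f : ℍ → ℂ) ∣[k] tpD d) ∣[k] tpB p ((j : ℕ) : ℤ) =
      (∑ j : Fin p, (⇑f : ℍ → ℂ) ∣[k] tpB p ((j : ℕ) : ℤ)) ∣[k] tpD d := by
  rw [SlashAction.sum_slash, ← (bijective_mulMod p d hp hd).sum_comp
    (fun j ↦ ((⇑f : ℍ → ℂ) ∣[k] tpB p ((j : ℕ) : ℤ)) ∣[k] tpD d)]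
  refine Finset.sum_congr rfl fun j _ ↦ ?_
  have hcast : (((d * j % p : ℕ) : ℕ) : ℤ) = (d : ℤ) * ((j : ℕ) : ℤ) % p := by push_cast; rfl
  rw [← SlashAction.slash_mul, tpD_mul_tpB, SlashAction.slash_mul, SlashAction.slash_mul]
  dsimp only
  rw [hcast]
  congr 2
  have hmem : (mapGL ℝ (T ^ ((d : ℤ) * ((j : ℕ) : ℤ) / p)) : GL (Fin 2) ℝ) ∈
      ((Gamma0 M₀ : Subgroup SL(2, ℤ)) : Subgroup (GL (Fin 2) ℝ)) :=
    ⟨T ^ ((d : ℤ) * ((j : ℕ) : ℤ) / p), T_zpow_mem_Gamma0 M₀ _, rfl⟩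
  exact SlashInvariantFormClass.slash_action_eq f _ hmem

end Reindex

/-! ### Full `p`-level is `p`-new: the `diag(1,p)` map -/

section PNewP

variable {p : ℕ} [NeZero p] {k : ℤ}

/-- **The adjoint map `[Γ₀(N) diag(1,p) Γ₀(M)]_k` kills `[diag(d,1)]_k n`** for `n ∈ S_k(Γ₀(M₀))`
killed by `[Γ₀(M₀) diag(1,p) Γ₀(Q)]_k`, when `N = p M = M₀ d c`, `M₀ = p Q`, `p ∤ d`, `p ∤ c`
(`v_p(M₀) = v_p(N)`). By Knapp 1993, Lemma 9.26 (as `coe_adjDegeneracyMap0_eq_sum`, `…_of_dvd`) the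
two adjoint maps are `U_p` (`p ∣ Q`) or `U_p + [diag(1,p) R]_k` (`p ∤ Q`, `R = (p, -v; M, u)` at
level `N`, `R' = (p, -dv; Qc, u)` at level `M₀`, `u p + v M = 1`); `U_p` commutes with
`[diag(d,1)]_k` (`sum_slash_tpD_slash_tpB`) and `diag(d,1) diag(1,p) R = diag(1,p) R' diag(d,1)`. [cite: Knapp1993, Lemma 9.26] -/
theorem adjDegeneracyMap0_p_degeneracyMap0_eq_zero (hp : p.Prime) {N M M₀ Q d c : ℕ} [NeZero N]
    [NeZero M] [NeZero M₀] [NeZero Q] [NeZero d] [NeZero c]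
    (hN : N = p * M) (hM₀ : M₀ = p * Q) (hL : M₀ * d * c = N) (hd : ¬ p ∣ d) (hc : ¬ p ∣ c)
    {n : CuspForm (Gamma0 M₀) k} (hn : adjDegeneracyMap0 M₀ Q p k n = 0) :
    adjDegeneracyMap0 N M p k (degeneracyMap0 M₀ N d k n) = 0 := by
  haveI : Fact p.Prime := ⟨hp⟩
  have hM : M = Q * d * c := by
    apply Nat.eq_of_mul_eq_mul_left hp.pos
    rw [← hN, ← hL, hM₀]; ring
  have hM₀d : M₀ * d ∣ N := ⟨c, hL.symm⟩
  apply DFunLike.coe_injective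
  rw [CuspForm.coe_zero]
  by_cases hpQ : p ∣ Q
  · -- `p² ∣ M₀`, `p² ∣ N`: both adjoint maps are `U_p`
    have hpM : p ∣ M := hM ▸ (hpQ.mul_right d).mul_right c
    rw [coe_adjDegeneracyMap0_eq_sum_of_dvd p N k hN hpM, coe_degeneracyMap0 M₀ N d k hM₀d,
      sum_slash_tpD_slash_tpB hp hd, ← coe_adjDegeneracyMap0_eq_sum_of_dvd p M₀ k hM₀ hpQ n, hn,
      CuspForm.coe_zero, SlashAction.zero_slash]
  · -- `p ∥ M₀`, `p ∥ N`: `U_p + [W_p]_k` at both levels, with compatible Atkin–Lehner matrices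
    have hcop : Nat.Coprime p M := by
      rw [hM, Nat.Prime.coprime_iff_not_dvd hp]
      intro h
      rcases (Nat.Prime.dvd_mul hp).mp h with h | h
      · rcases (Nat.Prime.dvd_mul hp).mp h with h | h
        · exact hpQ h
        · exact hd h
      · exact hc h
    obtain ⟨u, v, huv⟩ := Nat.isCoprime_iff_coprime.mpr hcop
    have hMR : (M : ℤ) = Q * c * d := by rw [hM]; push_cast; ring
    rw [hMR] at huv
    let A : Matrix (Fin 2) (Fin 2) ℤ := !![(p : ℤ), -v; Q * c * d, u]
    have hA : A.det = 1 := by rw [Matrix.det_fin_two_of]; linear_combination huv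
    let A' : Matrix (Fin 2) (Fin 2) ℤ := !![(p : ℤ), -(d * v); Q * c, u]
    have hA' : A'.det = 1 := by rw [Matrix.det_fin_two_of]; linear_combination huv
    let R : SL(2, ℤ) := ⟨A, hA⟩
    let R' : SL(2, ℤ) := ⟨A', hA'⟩
    have hR : (M : ℤ) ∣ R 1 0 := by rw [hMR]; simp [R, A]
    have hR0 : (p : ℤ) ∣ R 0 0 := by simp [R, A]
    have hR' : (Q : ℤ) ∣ R' 1 0 := by simp [R', A']
    have hR'0 : (p : ℤ) ∣ R' 0 0 := by simp [R', A']
    have hmat : tpD d * (tpG p * mapGL ℝ R) = tpG p * mapGL ℝ R' * tpD d := by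
      ext i j
      simp only [Units.val_mul, Matrix.SpecialLinearGroup.mapGL_coe_matrix, val_tpD, val_tpG]
      fin_cases i <;> fin_cases j <;>
        simp only [Matrix.mul_apply, Fin.sum_univ_two] <;>
        simp [R, R', A, A'] <;> ring
    rw [coe_adjDegeneracyMap0_eq_sum p N k hN hR hR0, coe_degeneracyMap0 M₀ N d k hM₀d,
      sum_slash_tpD_slash_tpB hp hd, ← SlashAction.slash_mul, hmat, SlashAction.slash_mul,
      ← SlashAction.add_slash]
    have h0 := coe_adjDegeneracyMap0_eq_sum p M₀ k hM₀ hR' hR'0 n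
    rw [hn, CuspForm.coe_zero] at h0
    rw [← h0, SlashAction.zero_slash]

end PNewP

/-! ### Fricke involutions versus degeneracy maps; full `p`-level is `p`-new -/

section Fricke

variable (N : ℕ) [NeZero N] (k : ℤ)

/-- **Adjoint degeneracy maps of `w_N f`**: for `M d d' = N`, if `[Γ₀(N) diag(1,d') Γ₀(M)]_k f = 0`
then `[Γ₀(N) diag(1,d) Γ₀(M)]_k (w_N f) = 0` — indeed the latter is `c d^{k-2} ([…d'…]_k f) ∣ w_M`,
by `w_N diag(1,d) = (d·1) diag(1,d') w_M` and transport of coset decompositions. This is the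
computation of `frickeInvolution_mem_newSubspace0` (`CuspFormLFunctionFrickeProofs`) with the
vanishing of a single adjoint map as hypothesis (Atkin–Lehner 1970, Lemma 26; it is the adjoint,
Diamond–Shurman Prop. 5.5.2, of the third diagram in the proof of Diamond–Shurman Prop. 5.6.2,
PDF p. 210). [cite: DiamondShurman2005, Prop. 5.6.2 (proof; third diagram; adjoint form)] -/
theorem adjDegeneracyMap0_frickeInvolution_eq_zero {M d d' : ℕ} [NeZero M] [NeZero d] [NeZero d']
    (hMdd' : M * d * d' = N) {f : CuspForm (Gamma0 N) k}
    (hf' : adjDegeneracyMap0 N M d' k f = 0) :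
    adjDegeneracyMap0 N M d k (frickeInvolution N k f) = 0 := by
  -- notation
  set wN := glCast (frickeGL N : GL (Fin 2) ℚ) with hwN
  set wM := glCast (frickeGL M : GL (Fin 2) ℚ) with hwM
  set Dd : GL (Fin 2) ℚ := (diagGL 1 d one_pos (Nat.cast_pos.mpr (NeZero.pos d)) : GL (Fin 2) ℚ)
    with hDd
  set Dd' : GL (Fin 2) ℚ := (diagGL 1 d' one_pos (Nat.cast_pos.mpr (NeZero.pos d')) : GL (Fin 2) ℚ)
    with hDd'
  set Sd := glCast (diagGL d d (Nat.cast_pos.mpr (NeZero.pos d)) (Nat.cast_pos.mpr (NeZero.pos d)) :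
    GL (Fin 2) ℚ) with hSd
  -- decompositions
  letI := Fintype.ofFinite ((Gamma0 M : Subgroup (GL (Fin 2) ℝ)) ⧸
    (ConjAct.toConjAct (glCast Dd)⁻¹ • (Gamma0 N : Subgroup (GL (Fin 2) ℝ))).subgroupOf (Gamma0 M))
  letI := Fintype.ofFinite ((Gamma0 M : Subgroup (GL (Fin 2) ℝ)) ⧸
    (ConjAct.toConjAct (glCast Dd')⁻¹ • (Gamma0 N : Subgroup (GL (Fin 2) ℝ))).subgroupOf (Gamma0 M))
  obtain ⟨m, α, hα⟩ := exists_isDoubleCosetDecomp (Gamma0 N : Subgroup (GL (Fin 2) ℝ))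
    (Gamma0 M) (glCast Dd)
  obtain ⟨m', β, hβ⟩ := exists_isDoubleCosetDecomp (Gamma0 N : Subgroup (GL (Fin 2) ℝ))
    (Gamma0 M) (glCast Dd')
  have hmul : ∀ a b : GL (Fin 2) ℚ, glCast (a * b) = glCast a * glCast b := fun a b ↦ map_mul _ a b
  have hA : IsDoubleCosetDecomp (Gamma0 N : Subgroup (GL (Fin 2) ℝ)) (Gamma0 M)
      (glCast ((frickeGL N : GL (Fin 2) ℚ) * Dd)) (fun i ↦ wN * α i) := by
    rw [hmul]
    exact hα.normaliser_mul (fun γ hγ ↦ frickeGL_mul_mul_inv_mem N hγ)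
      (fun γ hγ ↦ frickeGL_inv_mul_mul_mem N hγ)
  have hB : IsDoubleCosetDecomp (Gamma0 N : Subgroup (GL (Fin 2) ℝ)) (Gamma0 M)
      (glCast ((frickeGL N : GL (Fin 2) ℚ) * Dd)) (fun j ↦ Sd * β j * wM) := by
    rw [hmul, show glCast (frickeGL N : GL (Fin 2) ℚ) * glCast Dd = Sd * glCast Dd' * wM from
      frickeGL_mul_diagGL_one_eq N hMdd']
    exact hβ.centre_mul_mul_normaliser (diagGL_self_mul_comm d)
      (fun γ hγ ↦ frickeGL_mul_mul_inv_mem M hγ) (fun γ hγ ↦ frickeGL_inv_mul_mul_mem M hγ)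
  -- the computation, on underlying functions
  apply DFunLike.coe_injective
  have hfr := frickeInvolution_apply_eq_slash_holds N k
  have e1 : (⇑(adjDegeneracyMap0 N M d k (frickeInvolution N k f)) : ℍ → ℂ) =
      ∑ i, ⇑(frickeInvolution N k f) ∣[k] α i :=
    coe_cuspHeckeCorrespondence_eq_sum _ _ k Dd hα _
  have e2 : (⇑(cuspHeckeCorrespondence (Gamma0 N) (Gamma0 M) k ((frickeGL N : GL (Fin 2) ℚ) * Dd) f) :
      ℍ → ℂ) = ∑ i, ⇑f ∣[k] (wN * α i) :=
    coe_cuspHeckeCorrespondence_eq_sum _ _ k _ hA f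
  have e3 : (⇑(cuspHeckeCorrespondence (Gamma0 N) (Gamma0 M) k ((frickeGL N : GL (Fin 2) ℚ) * Dd) f) :
      ℍ → ℂ) = ∑ j, ⇑f ∣[k] (Sd * β j * wM) :=
    coe_cuspHeckeCorrespondence_eq_sum _ _ k _ hB f
  have e4 : (⇑(adjDegeneracyMap0 N M d' k f) : ℍ → ℂ) = ∑ j, ⇑f ∣[k] β j :=
    coe_cuspHeckeCorrespondence_eq_sum _ _ k Dd' hβ f
  rw [hf'] at e4
  rw [e1, hfr f, CuspForm.coe_zero]
  simp_rw [ModularForm.smul_slash, σ_ofReal, ← SlashAction.slash_mul]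
  rw [← Finset.smul_sum, ← hwN, ← e2, e3]
  simp_rw [SlashAction.slash_mul, hSd, slash_diagGL_self, ModularForm.smul_slash, σ_ofReal]
  rw [← Finset.smul_sum, ← SlashAction.sum_slash, ← e4, CuspForm.coe_zero, SlashAction.zero_slash,
    smul_zero, smul_zero]

variable {N k}

/-- **`w_N` carries `[diag(d,1)]_k S_k(Γ₀(M₀))` to `[diag(c,1)]_k S_k(Γ₀(M₀))`** for `M₀ d c = N`:
`w_N ([diag(d,1)]_k n) = C • [diag(c,1)]_k (w_{M₀} n)` with
`C = N^{1-k/2} d^{k-2} M₀^{k/2-1}` (Diamond–Shurman, proof of Prop. 5.6.2, third diagram,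
PDF p. 210: `w ∘ i_p = i_p ∘ (0, p^{k-2} w; w, 0)`; Atkin–Lehner 1970, Lemma 26). The `ι_d`-version
with explicit constants is `frickeInvolution_iota_smul_eq` of `NewformsHeckeStableProofs`, whose
matrix identity `tpD_mul_frickeGL_eq` is used here; this `degeneracyMap0` form with an unnamed
scalar is what `degeneracyMap0_mem_pNew` consumes. [cite: DiamondShurman2005, Prop. 5.6.2 (proof; third diagram)] -/
theorem exists_frickeInvolution_degeneracyMap0_eq_smul {M₀ d c : ℕ} [NeZero M₀] [NeZero d]
    [NeZero c] (h : M₀ * d * c = N) (n : CuspForm (Gamma0 M₀) k) :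
    ∃ C : ℂ, frickeInvolution N k (degeneracyMap0 M₀ N d k n) =
      C • degeneracyMap0 M₀ N c k (frickeInvolution M₀ k n) := by
  set cN : ℂ := (((N : ℝ) ^ (1 - (k : ℝ) / 2) : ℝ) : ℂ) with hcN
  set cM : ℂ := (((M₀ : ℝ) ^ (1 - (k : ℝ) / 2) : ℝ) : ℂ) with hcM
  set cd : ℂ := (((d : ℝ) ^ (k - 2) : ℝ) : ℂ) with hcd
  have hcM0 : cM ≠ 0 := by
    rw [hcM]; exact_mod_cast (Real.rpow_pos_of_pos (Nat.cast_pos.mpr (NeZero.pos M₀)) _).ne'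
  have hMd : M₀ * d ∣ N := ⟨c, h.symm⟩
  have hMc : M₀ * c ∣ N := ⟨d, by rw [← h]; ring⟩
  refine ⟨cN * cd * cM⁻¹, ?_⟩
  apply DFunLike.coe_injective
  have hwM : (⇑n : ℍ → ℂ) ∣[k] glCast (frickeGL M₀ : GL (Fin 2) ℚ) =
      cM⁻¹ • ⇑(frickeInvolution M₀ k n) := by
    rw [frickeInvolution_apply_eq_slash_holds M₀ k n, smul_smul, ← hcM, inv_mul_cancel₀ hcM0, one_smul]
  rw [frickeInvolution_apply_eq_slash_holds N k, coe_degeneracyMap0 M₀ N d k hMd,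
    ← SlashAction.slash_mul, tpD_mul_frickeGL_eq N h, SlashAction.slash_mul, SlashAction.slash_mul,
    slash_diagGL_self, ModularForm.smul_slash, σ_ofReal, ModularForm.smul_slash, σ_ofReal, hwM,
    ModularForm.smul_slash, CuspForm.IsGLPos.coe_smul, coe_degeneracyMap0 M₀ N c k hMc, smul_smul,
    smul_smul, ← hcN, ← hcd]
  congr 1
  have hdet : 0 < (tpD c).det.val := by rw [det_tpD]; exact_mod_cast NeZero.pos c
  rw [σ_eq_self hdet]

variable {p : ℕ} [NeZero p]

/-- **Full `p`-level is `p`-new.** Let `N = p M = M₀ d c` with `p ∤ d`, `p ∤ c` (so `p ∣ M₀`,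
`M₀ = p Q`, `v_p(M₀) = v_p(N)`), and `n ∈ S_k(Γ₀(M₀))^{new}`. Then `[Γ₀(M₀) diag(d,1) Γ₀(N)]_k n` is
`p`-new at level `N`: it is killed by `[Γ₀(N) diag(1,p) Γ₀(M)]_k`
(`adjDegeneracyMap0_p_degeneracyMap0_eq_zero`) and by the trace `[Γ₀(N) 1 Γ₀(M)]_k`, the latter
because `g = w_N ((-1)^k w_N g)` (`w_N² = (-1)^k`), `adj_1 (w_N ·) = c (adj_p ·) ∣ w_M`
(`adjDegeneracyMap0_frickeInvolution_eq_zero`), `w_N [diag(d,1)]_k n = C [diag(c,1)]_k (w_{M₀} n)`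
and `w_{M₀} n` is new (`frickeInvolution_mem_newSubspace0`). (The level-`Γ₀` refinement of
Diamond–Shurman Prop. 5.6.2; the `p`-new/`p`-old bookkeeping is that of Atkin–Lehner 1970, §4.) [folklore] -/
theorem degeneracyMap0_mem_pNew (hp : p.Prime) {N M M₀ Q d c : ℕ} [NeZero N]
    [NeZero M] [NeZero M₀] [NeZero Q] [NeZero d] [NeZero c]
    (hN : N = p * M) (hM₀ : M₀ = p * Q) (hL : M₀ * d * c = N) (hd : ¬ p ∣ d) (hc : ¬ p ∣ c)
    {n : CuspForm (Gamma0 M₀) k} (hn : n ∈ newSubspace0 M₀ k) :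
    degeneracyMap0 M₀ N d k n ∈
      LinearMap.ker (adjDegeneracyMap0 N M 1 k) ⊓ LinearMap.ker (adjDegeneracyMap0 N M p k) := by
  -- `n` and `w_{M₀} n` are `p`-new at level `M₀`
  have hnew : ∀ {n' : CuspForm (Gamma0 M₀) k}, n' ∈ newSubspace0 M₀ k →
      adjDegeneracyMap0 M₀ Q p k n' = 0 := fun hn' ↦
    LinearMap.mem_ker.mp (Submodule.mem_inf.mp (newSubspace0_le_pNew hM₀ hp.one_lt hn')).2
  have hL' : M₀ * c * d = N := by rw [← hL]; ring
  refine Submodule.mem_inf.mpr ⟨LinearMap.mem_ker.mpr ?_, LinearMap.mem_ker.mpr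
    (adjDegeneracyMap0_p_degeneracyMap0_eq_zero hp hN hM₀ hL hd hc (hnew hn))⟩
  -- the trace part, via `w_N`: `g = w_N ((-1)^k • w_N g)`
  set g := degeneracyMap0 M₀ N d k n with hg
  have hgw : g = frickeInvolution N k (((-1 : ℂ) ^ k) • frickeInvolution N k g) := by
    rw [LinearMap.map_smul, frickeInvolution_frickeInvolution_holds N k g, smul_smul,
      ← mul_zpow, neg_mul_neg, one_mul, one_zpow, one_smul]
  rw [hgw]
  refine adjDegeneracyMap0_frickeInvolution_eq_zero N k (d := 1) (d' := p)
    (by rw [hN]; ring) ?_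
  rw [LinearMap.map_smul]
  obtain ⟨C, hC⟩ := exists_frickeInvolution_degeneracyMap0_eq_smul (N := N) hL n
  rw [hg, hC, LinearMap.map_smul, adjDegeneracyMap0_p_degeneracyMap0_eq_zero hp hN hM₀ hL' hc hd
    (hnew (frickeInvolution_mem_newSubspace0 M₀ k hn)), smul_zero, smul_zero]

/-- **Full `p`-level is `p`-new**, for a whole Atkin–Lehner component:
`[diag(d,1)]_k S_k(Γ₀(M₀))^{new} ⊆ p-new` under the hypotheses of `degeneracyMap0_mem_pNew`. [folklore] -/
theorem map_degeneracyMap0_newSubspace0_le_pNew (hp : p.Prime) {N M M₀ Q d c : ℕ}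
    [NeZero N] [NeZero M] [NeZero M₀] [NeZero Q] [NeZero d] [NeZero c]
    (hN : N = p * M) (hM₀ : M₀ = p * Q) (hL : M₀ * d * c = N) (hd : ¬ p ∣ d) (hc : ¬ p ∣ c) :
    (newSubspace0 M₀ k).map (degeneracyMap0 M₀ N d k) ≤
      LinearMap.ker (adjDegeneracyMap0 N M 1 k) ⊓ LinearMap.ker (adjDegeneracyMap0 N M p k) := by
  rintro _ ⟨n, hn, rfl⟩
  exact degeneracyMap0_mem_pNew hp hN hM₀ hL hd hc hn

end Fricke

end Literature.NumberTheory.EllipticCurves.ModularForms
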